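import Mathlib
import Literature.Probability.LatticeModels.IsingThermodynamics

/-!
# Objects for item `DilutionTransfer` (stmt-CriticalPhenomena-6037), route `HarmonicMomentsIsotropy`

Definitions shared by the support files of the proof of
`Summit.CriticalPhenomena.Ising3DConformalLimit.Theses.HarmonicMomentsIsotropy.DilutionTransfer`
(the subcritical-to-critical transfer of harmonic dilution to asymptotic isotropy), together with
their basic API:

* `siteW`, `siteV` — a lattice site `x ∈ ℤ³` as a point of `ℝ³ = Fin 3 → ℝ` and of
  `EuclideanSpace ℝ (Fin 3)`;
* `latMeasure w t = ∑ₓ w(x) δ_{t • x}` — the weighted lattice measure on Euclidean `ℝ³`, with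
  `lintegral_latMeasure`, `latMeasure_apply`, `latMeasure_univ`, `integral_latMeasure_of_nonneg`,
  `integral_latMeasure`;
* `chi β = χ(β) = ∑ₓ ⟨σ₀σₓ⟩^∅_β`, `msq β = M₂(β) = ∑ₓ |x|² ⟨σ₀σₓ⟩^∅_β`, `xi β = ξ₂(β) = √(M₂/χ)`
  (second-moment correlation length) and the scaled two-point measure
  `nu β = χ(β)⁻¹ ∑ₓ ⟨σ₀σₓ⟩^∅_β δ_{x/ξ₂(β)}` on `EuclideanSpace ℝ (Fin 3)` — the objects of the planner's
  proof sketch of the item (route file, item stmt-CriticalPhenomena-6037).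

No mathematics beyond bookkeeping happens here.
-/

noncomputable section

open MeasureTheory Filter Topology Set
open scoped ENNReal NNReal BigOperators
open Literature.Probability.LatticeModels

namespace Summit.CriticalPhenomena.Ising3DConformalLimit.Theorems.HarmonicMomentsIsotropy

/-- Euclidean `ℝ³`. -/
abbrev V : Type := EuclideanSpace ℝ (Fin 3)

/-- A lattice site as a point of `Fin 3 → ℝ`. -/
def siteW (x : Site 3) : Fin 3 → ℝ := fun i => (x i : ℝ)

/-- A lattice site as a point of Euclidean `ℝ³`. -/
def siteV (x : Site 3) : V := WithLp.toLp 2 (siteW x)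

/-- Coordinates of `siteW`. -/
@[simp] theorem siteW_apply (x : Site 3) (i : Fin 3) : siteW x i = (x i : ℝ) := rfl

/-- Coordinates of `siteV`. -/
@[simp] theorem siteV_apply (x : Site 3) (i : Fin 3) : siteV x i = (x i : ℝ) := rfl

/-- `siteV` is injective. -/
theorem siteV_injective : Function.Injective siteV := by
  intro x y h
  funext i
  have := congrArg (fun v : V => v i) h
  simpa using this

/-! ## The weighted lattice measure -/

/-- The weighted lattice measure `∑ₓ w(x) δ_{t • x}` on Euclidean `ℝ³` (weights `w ≥ 0` intended;
negative weights are truncated to `0` by `ENNReal.ofReal`). -/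
def latMeasure (w : Site 3 → ℝ) (t : ℝ) : Measure V :=
  Measure.sum fun x : Site 3 => ENNReal.ofReal (w x) • Measure.dirac (t • siteV x)

/-- Lower Lebesgue integral against the lattice measure: `∫⁻ f = ∑ₓ w(x) f(t • x)`. -/
theorem lintegral_latMeasure (w : Site 3 → ℝ) (t : ℝ) (f : V → ℝ≥0∞) :
    ∫⁻ y, f y ∂(latMeasure w t) = ∑' x : Site 3, ENNReal.ofReal (w x) * f (t • siteV x) := by
  rw [latMeasure, lintegral_sum_measure]
  congr 1 with x
  rw [lintegral_smul_measure, lintegral_dirac, smul_eq_mul]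

/-- The lattice measure of a set: `∑_{x : t • x ∈ B} w(x)`. -/
theorem latMeasure_apply (w : Site 3 → ℝ) (t : ℝ) (B : Set V) [DecidablePred (· ∈ B)] :
    latMeasure w t B = ∑' x : Site 3, if t • siteV x ∈ B then ENNReal.ofReal (w x) else 0 := by
  rw [latMeasure, Measure.sum_apply_of_countable]
  congr 1 with x
  rw [Measure.smul_apply, Measure.dirac_apply, smul_eq_mul]
  by_cases h : t • siteV x ∈ B
  · rw [indicator_of_mem h, if_pos h]; simp
  · rw [indicator_of_notMem h, if_neg h]; simp

/-- Total mass of the lattice measure for nonnegative summable weights: `∑ₓ w(x)`. -/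
theorem latMeasure_univ {w : Site 3 → ℝ} (hw : ∀ x, 0 ≤ w x) (hs : Summable w) (t : ℝ) :
    latMeasure w t univ = ENNReal.ofReal (∑' x, w x) := by
  classical
  rw [latMeasure_apply]
  simp only [mem_univ, if_true]
  rw [ENNReal.ofReal_tsum_of_nonneg hw hs]

/-- The lattice measure is finite for nonnegative summable weights. -/
theorem isFiniteMeasure_latMeasure {w : Site 3 → ℝ} (hw : ∀ x, 0 ≤ w x) (hs : Summable w)
    (t : ℝ) : IsFiniteMeasure (latMeasure w t) := by
  refine ⟨?_⟩
  rw [latMeasure_univ hw hs]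
  exact ENNReal.ofReal_lt_top

/-- The lattice measure is a probability measure when the nonnegative weights sum to `1`. -/
theorem isProbabilityMeasure_latMeasure {w : Site 3 → ℝ} (hw : ∀ x, 0 ≤ w x) (hs : Summable w)
    (h1 : ∑' x, w x = 1) (t : ℝ) : IsProbabilityMeasure (latMeasure w t) := by
  refine ⟨?_⟩
  rw [latMeasure_univ hw hs, h1, ENNReal.ofReal_one]

/-- Integral of a nonnegative measurable function against the lattice measure (nonnegative weights,
summable integrand): `∫ f = ∑ₓ w(x) f(t • x)`. -/
theorem integral_latMeasure_of_nonneg {w : Site 3 → ℝ} (hw : ∀ x, 0 ≤ w x) (t : ℝ) {f : V → ℝ}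
    (hf : Measurable f) (hf0 : ∀ y, 0 ≤ f y) (hs : Summable fun x => w x * f (t • siteV x)) :
    ∫ y, f y ∂(latMeasure w t) = ∑' x, w x * f (t • siteV x) := by
  rw [integral_eq_lintegral_of_nonneg_ae (ae_of_all _ hf0) hf.aestronglyMeasurable,
    lintegral_latMeasure]
  have h : ∀ x, ENNReal.ofReal (w x) * ENNReal.ofReal (f (t • siteV x)) =
      ENNReal.ofReal (w x * f (t • siteV x)) := fun x => by rw [ENNReal.ofReal_mul (hw x)]
  simp_rw [h]
  rw [← ENNReal.ofReal_tsum_of_nonneg (fun x => mul_nonneg (hw x) (hf0 _)) hs,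
    ENNReal.toReal_ofReal (tsum_nonneg fun x => mul_nonneg (hw x) (hf0 _))]

/-- Integrability against the lattice measure from absolute summability. -/
theorem integrable_latMeasure {w : Site 3 → ℝ} (hw : ∀ x, 0 ≤ w x) (t : ℝ) {f : V → ℝ}
    (hf : Measurable f) (hs : Summable fun x => w x * |f (t • siteV x)|) :
    Integrable f (latMeasure w t) := by
  refine ⟨hf.aestronglyMeasurable, ?_⟩
  rw [hasFiniteIntegral_iff_norm, lintegral_latMeasure]
  have h : ∀ x, ENNReal.ofReal (w x) * ENNReal.ofReal ‖f (t • siteV x)‖ =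
      ENNReal.ofReal (w x * |f (t • siteV x)|) := fun x => by
    rw [ENNReal.ofReal_mul (hw x), Real.norm_eq_abs]
  simp_rw [h]
  rw [← ENNReal.ofReal_tsum_of_nonneg (fun x => mul_nonneg (hw x) (abs_nonneg _)) hs]
  exact ENNReal.ofReal_lt_top

/-- Integral of a measurable function against the lattice measure (nonnegative weights, absolutely
summable integrand): `∫ f = ∑ₓ w(x) f(t • x)`. -/
theorem integral_latMeasure {w : Site 3 → ℝ} (hw : ∀ x, 0 ≤ w x) (t : ℝ) {f : V → ℝ}
    (hf : Measurable f) (hs : Summable fun x => w x * |f (t • siteV x)|) :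
    ∫ y, f y ∂(latMeasure w t) = ∑' x, w x * f (t • siteV x) := by
  -- split into positive and negative parts
  set fp : V → ℝ := fun y => max (f y) 0 with hfp
  set fm : V → ℝ := fun y => max (-f y) 0 with hfm
  have hfpm : ∀ y, f y = fp y - fm y := fun y => by
    simp only [hfp, hfm]; rcases le_total (f y) 0 with h | h
    · rw [max_eq_right h, max_eq_left (by linarith)]; ring
    · rw [max_eq_left h, max_eq_right (by linarith)]; ring
  have hsp : Summable fun x => w x * fp (t • siteV x) := by
    refine hs.of_nonneg_of_le (fun x => mul_nonneg (hw x) (le_max_right _ _)) fun x => ?_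
    exact mul_le_mul_of_nonneg_left (max_le (le_abs_self _) (abs_nonneg _)) (hw x)
  have hsm : Summable fun x => w x * fm (t • siteV x) := by
    refine hs.of_nonneg_of_le (fun x => mul_nonneg (hw x) (le_max_right _ _)) fun x => ?_
    exact mul_le_mul_of_nonneg_left (max_le (neg_le_abs _) (abs_nonneg _)) (hw x)
  have hmp : Measurable fp := hf.max measurable_const
  have hmm : Measurable fm := hf.neg.max measurable_const
  have hip : Integrable fp (latMeasure w t) := by
    refine integrable_latMeasure hw t hmp (hsp.congr fun x => ?_)
    rw [abs_of_nonneg (le_max_right _ _)]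
  have him : Integrable fm (latMeasure w t) := by
    refine integrable_latMeasure hw t hmm (hsm.congr fun x => ?_)
    rw [abs_of_nonneg (le_max_right _ _)]
  calc ∫ y, f y ∂(latMeasure w t) = ∫ y, (fp y - fm y) ∂(latMeasure w t) := by
        simp_rw [← hfpm]
    _ = ∫ y, fp y ∂(latMeasure w t) - ∫ y, fm y ∂(latMeasure w t) := integral_sub hip him
    _ = ∑' x, w x * fp (t • siteV x) - ∑' x, w x * fm (t • siteV x) := by
        rw [integral_latMeasure_of_nonneg hw t hmp (fun y => le_max_right _ _) hsp,
          integral_latMeasure_of_nonneg hw t hmm (fun y => le_max_right _ _) hsm]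
    _ = ∑' x, (w x * fp (t • siteV x) - w x * fm (t • siteV x)) := (hsp.tsum_sub hsm).symm
    _ = ∑' x, w x * f (t • siteV x) := by
        congr 1 with x; rw [hfpm]; ring

/-! ## The subcritical two-point data: `χ`, `M₂`, `ξ₂`, `ν_β` -/

/-- The susceptibility `χ(β) = ∑ₓ ⟨σ₀σₓ⟩^∅_{β,0}` as a real series (the `tsum`; it is the genuine sum
for `0 ≤ β < β_c`, where the series converges). -/
def chi (β : ℝ) : ℝ := ∑' x : Site 3, twoPointFree 3 β x

/-- The second moment `M₂(β) = ∑ₓ |x|² ⟨σ₀σₓ⟩^∅_{β,0}` (Euclidean `|x|² = ∑ᵢ xᵢ²`). -/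
def msq (β : ℝ) : ℝ := ∑' x : Site 3, (∑ i, ((x i : ℝ)) ^ 2) * twoPointFree 3 β x

/-- The second-moment correlation length `ξ₂(β) = √(M₂(β)/χ(β))`. -/
def xi (β : ℝ) : ℝ := Real.sqrt (msq β / chi β)

/-- The scaled two-point measure `ν_β = χ(β)⁻¹ ∑ₓ ⟨σ₀σₓ⟩^∅_β δ_{x/ξ₂(β)}` on Euclidean `ℝ³`. -/
def nu (β : ℝ) : Measure V := latMeasure (fun x => twoPointFree 3 β x / chi β) (xi β)⁻¹

/-- `ξ₂ ≥ 0`. -/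
theorem xi_nonneg (β : ℝ) : 0 ≤ xi β := Real.sqrt_nonneg _

end Summit.CriticalPhenomena.Ising3DConformalLimit.Theorems.HarmonicMomentsIsotropy

end
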